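import Mathlib
import HarnessLib
import HarnessLib.Audit
import Summits.CriticalPhenomena.Ising3DConformalLimit.Theses.PrecisionLaplacian
import Summits.CriticalPhenomena.Ising3DConformalLimit.Theorems.PrecisionLaplacianDirectCorrelationStableTailSlabSpectralRepresentation
import Summits.CriticalPhenomena.Ising3DConformalLimit.Theorems.PrecisionLaplacianDirectCorrelationStableTailDcfStructure
import Summits.CriticalPhenomena.Ising3DConformalLimit.Theorems.PrecisionLaplacianDirectCorrelationStableTailPickInversion
import Summits.CriticalPhenomena.Ising3DConformalLimit.Theorems.PrecisionLaplacianDirectCorrelationStableTailScaleRegularity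
import Summits.CriticalPhenomena.Ising3DConformalLimit.Theorems.PrecisionLaplacianDirectCorrelationStableTailPointwiseUpgrade
import Literature.MeasureTheory.Moments.HausdorffMomentGeometricDecay
import Literature.Probability.LatticeModels.CriticalTwoPointLawDimension
import Summits.CriticalPhenomena.Ising3DConformalLimit.Theorems.PrecisionLaplacianEtaBoundsTransferLimit
import Summits.CriticalPhenomena.Ising3DConformalLimit.Theorems.PrecisionLaplacianDirectCorrelationStableTailSlabModeExpDecayGreenTransfer
import Summits.CriticalPhenomena.Ising3DConformalLimit.Theorems.PrecisionLaplacianDirectCorrelationStableTailSlabModeExpDecayAxisLineHol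
import Summits.CriticalPhenomena.Ising3DConformalLimit.Theorems.PrecisionLaplacianDirectCorrelationStableTailSlabModeExpDecayDiagLineHol
import Summits.CriticalPhenomena.Ising3DConformalLimit.Theorems.PrecisionLaplacianDirectCorrelationStableTailSlabModeExpDecayCrossAssembly
import Summits.CriticalPhenomena.Ising3DConformalLimit.Theorems.PrecisionLaplacianDirectCorrelationStableTailCrossLemma
import Summits.CriticalPhenomena.Ising3DConformalLimit.Theorems.PrecisionLaplacianDirectCorrelationStableTailLinearTransverseGapAux
import Summits.CriticalPhenomena.Ising3DConformalLimit.Theorems.PrecisionLaplacianDirectCorrelationStableTailClosureModuloCore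
import Summits.CriticalPhenomena.Ising3DConformalLimit.Theorems.PrecisionLaplacianDirectCorrelationStableTailMonotoneTauberian
import Summits.CriticalPhenomena.Ising3DConformalLimit.Theorems.PrecisionLaplacianDirectCorrelationStableTailSlabFunctionalLimit
import Summits.CriticalPhenomena.Ising3DConformalLimit.Theorems.PrecisionLaplacianDirectCorrelationStableTailAxisMarginal
import Summits.CriticalPhenomena.Ising3DConformalLimit.Theorems.PrecisionLaplacianDirectCorrelationStableTailScalingOfStableTail

/-!
# Line `self-energy-pick-inversion` — skeleton for crux `DirectCorrelationStableTail`
(item stmt-CriticalPhenomena-4799, route `PrecisionLaplacian`, rank 3) — LEAD'S RESHAPE rev 6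
(continuation lead prover-line-stmt-CriticalPhenomena-4799-c1-0, 2026-08-16; rev 1–4 by prover-line-stmt-CriticalPhenomena-4799-0;
planner's skeleton: planner-cruxplan-stmt-CriticalPhenomena-4799-self-energy-pick-inv-0).

Crux (by name, `crux_iff` below): `H → TAIL` at `G := criticalTwoPoint 3`, where
`H` = every finite kernel matrix `G_A` is a symmetric potential and
`TAIL` = the direct correlation function `a = dcf` (`a(x) = inf_{A ∋ 0,x} −(G_A)⁻¹(0,x)`) satisfies
`a(x)|x|₂^{5−η} − Φ(x̂) → 0` cofinitely, `η ∈ (0,1)`, `Φ ≥ 0` continuous, `Φ ≢ 0`.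

## STATUS rev 6 (2026-08-16, continuation, after wave 1): THE CRUX IS CLOSED MODULO — AND EQUIVALENT TO — THE CANONICAL CORE
All four Ising-free stubs of rev 5 LANDED in one wave (`stub_monotoneTauberian` p124296, `stub_slabFunctionalLimit` p125693
(+ aux p124305), `stub_axisMarginal` p124380, `stub_scalingOfStableTail` p124341).  The ONLY `sorry` left is the open core
`stub_stableLevyScaling`; `DirectCorrelationStableTail_of` is the crux modulo exactly that, and `stableLevyScaling_of_crux`
shows the core is NECESSARY: crux ⟺ core (tree file `…ClosureModuloStableScaling`, theorem
`directCorrelationStableTail_iff_stableLevyScalingCore`).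

## STATUS rev 5 (2026-08-16, continuation): THE OPEN CORE IS RESHAPED TO ITS CANONICAL MEASURE-LEVEL FORM
Rev 4 closed the crux modulo ONE stub, `stub_tailRegularVariation` (landed closure `stub_closureModuloCore`, p121716):
`H → a ∈ ℓ¹ → Hausdorff slabs → transverse gap → ∃ η ∈ (0,1), c > 0, (Rad) S⁽ⁱ⁾(n)·n^{3−η} → c ∧ (TMC) the rescaled
tail measures converge`.  That statement is line-specific (slab sums, Hausdorff hypotheses) and bundles the radial law with
the angular law.  Rev 5 replaces it by the statement the crux's own "Reading" clause names, in standard probabilistic language: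

* NEW OPEN CORE `stub_stableLevyScaling` (held by the lead; to be PROMOTED): under `H` there are `α ∈ (1,2)` and an angular
  profile `Φ ∈ C(S²)`, `Φ ≥ 0`, `Φ ≢ 0`, with STABLE LÉVY SCALING of the direct correlation function:
  `R^α Σ_x a(x) f(x/R) → ∫ f(y) Φ(ŷ)|y|₂^{−3−α} dy` for every `f ∈ C_c(ℝ³∖0)` (`R → ∞` in `ℕ`) — the step law `q = a/A₀` is
  in the domain of normal attraction of a genuinely three-dimensional symmetric `α`-stable law with continuous angular Lévy
  density `Φ` (vague convergence of the rescaled jump measures; `α = 2 − η`).  This is where `η(3) > 0` and pure-power scaling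
  live; it is FALSE for the Disproof's witnesses `δ₀`, `G₀` (there `a` vanishes off the unit ball) and untouched by any tree fact.
* (Rad) BECOMES A THEOREM modulo three ISING-FREE stubs sized for one worker each:
  `stub_monotoneTauberian` (a non-increasing sequence whose rescaled counting functionals converge to `F∫g s^{−1−α}` has
  `S(n) n^{1+α} → F`: sandwich), `stub_slabFunctionalLimit` (3-d vague scaling + summability + evenness ⇒ the slab-sum
  functionals converge to `½∫ g(|y_i|)Ψ`, via a dyadic tail bound and a cut-off), `stub_axisMarginal` (dilation identity
  `∫ g(|y_i|)Φ(ŷ)|y|^{−3−α} = F_i ∫ g(s)s^{−1−α}`, `F_i > 0`, integrability away from `0`); complete monotonicity of the slab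
  sums is the landed Pick inversion; (TMC) is literal.
* `stub_scalingOfStableTail` (Ising-free, lattice Riemann sums): TAIL ⇒ stable Lévy scaling.  Hence the reshaped core is
  EQUIVALENT to the crux's conclusion under `H` (`stableLevyScaling_of_crux` below): nothing stronger than the crux is bet.
* Composition: `DirectCorrelationStableTail_of : DirectCorrelationStableTail` is the crux proof MODULO the `stub_*` of §2
  (four provable now + the open core), through `core_of_stableLevyScaling` (sorry-free glue, §4b) and the landed
  `stub_closureModuloCore`.

## STATUS rev 4 (2026-08-16, after wave 4): EVERYTHING BUT THE EXISTENCE CORE IS PROVED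
* `stub_crossLemma` LANDED (p121603): the cross lemma follows from the tree's proved local cross theorem
  `Literature.Analysis.Complex.exists_holomorphic_extension_of_separately_local_fintype` (+ Osgood + the identity
  theorem on the arms).  With waves 2–3 this PROVES the transverse mass gap: `H → HasSlabModeExpDecay dcf`
  (`hasSlabModeExpDecay_dcf_of_crossLemma stub_crossLemma`), hence `H → HasTransverseGap dcf` — the LINEAR
  transverse mass gap of the critical 3-D Ising two-point function's precision symbol, from nine-frame reflection
  positivity + the Bernstein–Siciak cross theorem + Pick inversion.
* Rev 4's only `sorry` was `stub_tailRegularVariation` (the existence core in slab form); `stub_closureModuloCore` (p121716)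
  is the crux modulo exactly that statement, and rev 5 DERIVES that statement from the new core (`core_of_stableLevyScaling`).

## Earlier history (rev 1–3, prover-line-stmt-CriticalPhenomena-4799-0)
* LANDED (imported below, kernel-checked tree theorems in this namespace): `stub_slabSpectralRepresentation`
  (p85632), `stub_dcfStructure` (p91158 + 2 aux), `stub_pickInversion` (p99412 + 16 aux: a genuine Pick inversion
  through the tree's `nevanlinna_representation_holds` and `EtaBoundsTransfer.limit_equation`),
  `stub_scaleRegularity` (p91507 + 6 aux), `stub_pointwiseUpgrade` (p91049 + 3 aux); glue
  `transverseGap_of_hausdorff_of_eventually_expDecay` (file `…LinearTransverseGapAux`, + Literature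
  `MeasureTheory/Moments/HausdorffMomentGeometricDecay`); the transverse-mass-gap chain (`…SlabModeExpDecay*`,
  `…CrossLemma`).
* REGISTERED SIGNATURES ARE FULLY EXPANDED over tree/Mathlib declarations (`criticalTwoPoint`, `Site`,
  `Matrix.of`, `⨅`, `∑'`, `Fin.insertNth`, …): every stub lands as a DEF-FREE theorem file under `Theorems/`
  (kernel-reviewed fast lane).  The readable packages (`IsSymmPotentialKernel`, `directCorr`/`dcf`, `slabMode`,
  `IsSlabHausdorff`, `HasStableLevyScaling`, …, all PARAMETRISED by the kernel `G` or the function `a`) stay below and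
  `stub_X_iff : <expanded> ↔ <package form> := Iff.rfl` certifies each expansion.

Disproof.lean (cycle 2, re-read 2026-08-16T20Z; no `-- Targets` section, no `Negative/` lemma landed — nothing to import)
honoured: §2/§3 (`H` alone, or `H` + envelope + local Simon–Lieb, never claimed to give TAIL: every provable stub holds for
`G₀` too, the open core fails for it); §5/§7.3 (a parity-modulated / Williamson-type `a` has measure-level scaling but no
pointwise tail: exactly the gap closed by the landed stubs 5+7 from Hausdorff slabs + transverse gap, which such an `a`
violates); §6 (every stub is covariant under `a ↦ c·a`).
-/

noncomputable section

namespace Summit.CriticalPhenomena.Ising3DConformalLimit.Cruxes.DirectCorrelationStableTail.SelfEnergyPickInversion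

open MeasureTheory Filter Topology
open scoped BigOperators
open Literature.Probability.LatticeModels
open Summit.CriticalPhenomena.Ising3DConformalLimit.Theses.PrecisionLaplacian (DirectCorrelationStableTail)

/-! ## §0 Vocabulary (parametrised packages; the crux's own inlined objects with the kernel abstracted) -/

/-- The kernel matrix `G_A = (G (q − p))_{p,q ∈ A}` of `G : ℤ³ → ℝ` on a finite `A ⊂ ℤ³`
(the route's inlined `Matrix.of fun (p q : ↥A) => criticalTwoPoint 3 (q.1 - p.1)` with `G` abstracted). -/
abbrev kernelMatrix (G : Site 3 → ℝ) (A : Finset (Site 3)) : Matrix ↥A ↥A ℝ :=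
  Matrix.of fun (p q : ↥A) => G (q.1 - p.1)

/-- `H(G)`: every finite kernel matrix of `G` is a SYMMETRIC POTENTIAL — positive definite, inverse a
Z-matrix with nonnegative row sums (the crux's antecedent with `criticalTwoPoint 3` abstracted). -/
def IsSymmPotentialKernel (G : Site 3 → ℝ) : Prop :=
  ∀ A : Finset (Site 3), (kernelMatrix G A).PosDef ∧
    ∀ u v : ↥A, (u ≠ v → (kernelMatrix G A)⁻¹ u v ≤ 0) ∧ 0 ≤ ∑ w, (kernelMatrix G A)⁻¹ u w

/-- The direct correlation function `a(x) = inf_{A ∋ 0,x} −(G_A)⁻¹(0,x)` of a kernel `G` (the route's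
inlined object; a genuine monotone limit under `H`, a bare `Real.iInf` otherwise). -/
def directCorr (G : Site 3 → ℝ) (x : Site 3) : ℝ :=
  ⨅ A : {A : Finset (Site 3) // (0 : Site 3) ∈ A ∧ x ∈ A}, -((kernelMatrix G A.1)⁻¹ ⟨0, A.2.1⟩ ⟨x, A.2.2⟩)

/-- `dcf`: the direct correlation function of the CRITICAL kernel `criticalTwoPoint 3`. -/
abbrev dcf : Site 3 → ℝ := directCorr (criticalTwoPoint 3)

/-- Euclidean length `|x|₂` of a lattice point (as written in the crux). -/
def euclidNorm (x : Site 3) : ℝ := Real.sqrt (∑ j, ((x j : ℝ)) ^ 2)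

/-- The direction `x̂ = x/|x|₂` (junk at `x = 0`, as in the crux). -/
def direction (x : Site 3) : Fin 3 → ℝ := fun i => (x i : ℝ) / euclidNorm x

/-- `TAIL(a)`: the crux's consequent with the direct correlation function abstracted to `a`. -/
def HasStableTail (a : Site 3 → ℝ) : Prop :=
  ∃ (η : ℝ) (Φ : (Fin 3 → ℝ) → ℝ), 0 < η ∧ η < 1 ∧ ContinuousOn Φ {u | ∑ i, u i ^ 2 = 1} ∧
    (∀ u : Fin 3 → ℝ, ∑ i, u i ^ 2 = 1 → 0 ≤ Φ u) ∧ (∃ u : Fin 3 → ℝ, ∑ i, u i ^ 2 = 1 ∧ 0 < Φ u) ∧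
    Tendsto (fun x : Site 3 => a x * euclidNorm x ^ (5 - η) - Φ (direction x)) cofinite (𝓝 0)

/-- The crux is LITERALLY `H(criticalTwoPoint 3) → TAIL(dcf)` (definitional unfolding only). -/
theorem crux_iff : DirectCorrelationStableTail ↔ (IsSymmPotentialKernel (criticalTwoPoint 3) → HasStableTail dcf) :=
  Iff.rfl

/-! ## §1 Slab geometry and the abstract packages (parametrised by a function `a : ℤ³ → ℝ`) -/

/-- The lattice point whose `i`-th coordinate is `n` and whose two remaining coordinates (in increasing order) are `y`. -/
def slabPoint (i : Fin 3) (n : ℤ) (y : Fin 2 → ℤ) : Site 3 := Fin.insertNth i n y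

/-- Transverse Fourier mode of `a` in the slab `{x_i = n}`: `â⁽ⁱ⁾_n(k) = Σ_{y ∈ ℤ²} a(slabPoint i n y) cos(k·y)`
(a `tsum`: an honest sum iff the slab profile is summable, else the junk value `0`). -/
def slabMode (a : Site 3 → ℝ) (i : Fin 3) (n : ℕ) (k : Fin 2 → ℝ) : ℝ :=
  ∑' y : Fin 2 → ℤ, a (slabPoint i n y) * Real.cos (∑ j, k j * (y j : ℝ))

/-- Slab sum `S⁽ⁱ⁾(n) = Σ_{y ∈ ℤ²} a(slabPoint i n y) = â⁽ⁱ⁾_n(0)`. -/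
def slabSum (a : Site 3 → ℝ) (i : Fin 3) (n : ℕ) : ℝ :=
  ∑' y : Fin 2 → ℤ, a (slabPoint i n y)

/-- `a` is invariant under the hyperoctahedral group (coordinate permutations and sign changes). -/
def IsHyperoctahedralInvariant (a : Site 3 → ℝ) : Prop :=
  (∀ (σ : Equiv.Perm (Fin 3)) (x : Site 3), a (fun j => x (σ j)) = a x) ∧
    ∀ (j : Fin 3) (x : Site 3), a (Function.update x j (-x j)) = a x

/-- OUTPUT OF THE LEVER for `a`: for every direction `i` and EVERY transverse momentum `k`,
`(â⁽ⁱ⁾_{m+1}(k))_{m ≥ 0}` is a Hausdorff moment sequence: `â⁽ⁱ⁾_n(k) = ∫_{[0,1]} λ^{n-1} dτ`, `n ≥ 1`,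
`τ = τ⁽ⁱ⁾_k` finite positive on `[0,1]` (an atom at `0` = the nearest-neighbour part is allowed). -/
def IsSlabHausdorff (a : Site 3 → ℝ) : Prop :=
  ∀ (i : Fin 3) (k : Fin 2 → ℝ), ∃ τ : Measure ℝ, IsFiniteMeasure τ ∧ τ (Set.Icc (0 : ℝ) 1)ᶜ = 0 ∧
    ∀ n : ℕ, 1 ≤ n → slabMode a i n k = ∫ t, t ^ (n - 1) ∂τ

/-- LINEAR TRANSVERSE GAP for `a` (measure-free form): `â⁽ⁱ⁾_{n+1}(k) ≤ e^{-c‖k‖} â⁽ⁱ⁾_n(k)` for `n ≥ 1` and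
reduced momenta `k ∈ [-π,π]²` (sup norm); i.e. `τ⁽ⁱ⁾_k` is carried by `[0, e^{-c‖k‖}]`, mass gap `m(k) ≥ c‖k‖`. -/
def HasTransverseGap (a : Site 3 → ℝ) : Prop :=
  ∃ c : ℝ, 0 < c ∧ ∀ (i : Fin 3) (k : Fin 2 → ℝ), (∀ j, |k j| ≤ Real.pi) →
    ∀ n : ℕ, 1 ≤ n → slabMode a i (n + 1) k ≤ Real.exp (-(c * ‖k‖)) * slabMode a i n k

/-- EXPONENTIAL DECAY OF THE SLAB MODES of `a` (limsup form; the transverse mass gap `m(k) ≥ c‖k‖`):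
`∃ c > 0`, for every direction, every reduced `k ∈ [-π,π]²` and every rate `c' < c`, eventually
`â⁽ⁱ⁾_n(k) ≤ C e^{-c'‖k‖n}`.  Equivalent to `HasTransverseGap a` under `IsSlabHausdorff a`. -/
def HasSlabModeExpDecay (a : Site 3 → ℝ) : Prop :=
  ∃ c : ℝ, 0 < c ∧ ∀ (i : Fin 3) (k : Fin 2 → ℝ), (∀ j, |k j| ≤ Real.pi) → ∀ c' : ℝ, 0 < c' → c' < c →
    ∃ C : ℝ, ∀ᶠ n : ℕ in atTop, slabMode a i n k ≤ C * Real.exp (-(c' * ‖k‖ * (n : ℝ)))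

/-- RADIAL ASYMPTOTICS of `a` with exponent `η` and constant `c`: `S⁽ⁱ⁾(n)·n^{3-η} → c` in every direction. -/
def HasRadialAsymptotics (a : Site 3 → ℝ) (η c : ℝ) : Prop :=
  ∀ i : Fin 3, Tendsto (fun n : ℕ => slabSum a i n * (n : ℝ) ^ (3 - η)) atTop (𝓝 c)

/-- REGULARITY AT SCALE of `a` with exponent `η` (the derived `T_reg`): (R1) `a(x)|x|₂^{5-η}` bounded;
(R2) asymptotically equicontinuous at its own scale; (R3) slab tightness. -/
def IsRegularAtScale (a : Site 3 → ℝ) (η : ℝ) : Prop :=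
  (∃ C : ℝ, ∀ x : Site 3, x ≠ 0 → a x * euclidNorm x ^ (5 - η) ≤ C) ∧
  (∀ ε : ℝ, 0 < ε → ∃ δ : ℝ, 0 < δ ∧ ∃ R₀ : ℝ, ∀ x y : Site 3, R₀ ≤ euclidNorm x →
      euclidNorm (x - y) ≤ δ * euclidNorm x →
        |a x * euclidNorm x ^ (5 - η) - a y * euclidNorm y ^ (5 - η)| ≤ ε) ∧
  (∀ ε : ℝ, 0 < ε → ∃ K : ℝ, 0 < K ∧ ∃ N₀ : ℕ, ∀ (i : Fin 3) (n : ℕ), N₀ ≤ n →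
      (∑' y : Fin 2 → ℤ, if K * (n : ℝ) < ‖y‖ then a (slabPoint i n y) else 0) ≤ ε * slabSum a i n)

/-- TAIL MEASURES of `a` CONVERGE with exponent `η` (the card's `T_ang`, measure level): for every continuous
compactly supported `f` vanishing near `0`, `R^{2-η} Σ_x a(x) f(x/R)` has a limit as `R → ∞` through `ℕ`. -/
def TailMeasuresConverge (a : Site 3 → ℝ) (η : ℝ) : Prop :=
  ∀ f : (Fin 3 → ℝ) → ℝ, Continuous f → HasCompactSupport f → (0 : Fin 3 → ℝ) ∉ tsupport f →
    ∃ L : ℝ, Tendsto (fun R : ℕ => (R : ℝ) ^ (2 - η) * ∑' x : Site 3, a x * f (fun j => (x j : ℝ) / (R : ℝ)))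
      atTop (𝓝 L)

/-- SLAB SPECTRAL REPRESENTATION of a kernel `G` (ADC21 Prop. 8.6, finitely-supported `v`, each coordinate
direction): `n ↦ Σ_{x,y} v(x) v(y) G(slabPoint i n (x − y))` is a Hausdorff moment sequence on `[0,1]`. -/
def HasSlabSpectralRepresentation (G : Site 3 → ℝ) : Prop :=
  ∀ (i : Fin 3) (s : Finset (Fin 2 → ℤ)) (v : (Fin 2 → ℤ) → ℝ),
    ∃ μ : Measure ℝ, IsFiniteMeasure μ ∧ μ (Set.Icc (0 : ℝ) 1)ᶜ = 0 ∧
      ∀ n : ℕ, ∑ x ∈ s, ∑ y ∈ s, v x * v y * G (slabPoint i n (x - y)) = ∫ t, t ^ n ∂μ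

/-- The 3-fold CROSS THEOREM for intervals in discs (Bernstein 1912 for two variables; Siciak, Ann. Polon. Math.
22 (1969/70); Jarnicki–Pflug, Trans. AMS 355 (2003) = arXiv:math/0112082, Main Theorem with `M = ∅`,
`A_j = [-1,1] ⊂ D_j = {|z| < 2}` locally regular): a function of three complex variables that is SEPARATELY
holomorphic on the cross `X = ⋃ⱼ A × ⋯ × D_j × ⋯ × A` (one variable in the disc, the others REAL in `[-1,1]`) and
bounded by `M` there agrees on `X` near `0` with a function holomorphic on a fixed polydisc `{‖zᵢ‖ < ρ}` bounded by the
same `M`.  Text identical to `CrossLemma` of the sibling skeleton `Lines/nine_frame_cross_analyticity.lean`. -/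
def CrossLemma : Prop :=
  ∃ ρ : ℝ, 0 < ρ ∧ ∀ (f : (Fin 3 → ℂ) → ℂ) (M : ℝ),
    (∀ (j : Fin 3) (a : Fin 3 → ℝ), (∀ i, |a i| ≤ 1) →
        DifferentiableOn ℂ (fun z : ℂ => f (Function.update (fun i => ((a i : ℝ) : ℂ)) j z))
          (Metric.ball (0 : ℂ) 2)) →
    (∀ (j : Fin 3) (a : Fin 3 → ℝ) (z : ℂ), (∀ i, |a i| ≤ 1) → ‖z‖ < 2 →
        ‖f (Function.update (fun i => ((a i : ℝ) : ℂ)) j z)‖ ≤ M) →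
    ∃ g : (Fin 3 → ℂ) → ℂ, AnalyticOnNhd ℂ g {z | ∀ i, ‖z i‖ < ρ} ∧
      (∀ z : Fin 3 → ℂ, (∀ i, ‖z i‖ < ρ) → ‖g z‖ ≤ M) ∧
      ∀ (j : Fin 3) (a : Fin 3 → ℝ) (z : ℂ), (∀ i, |a i| ≤ 1) → ‖z‖ < 2 →
        (∀ i, ‖Function.update (fun i => ((a i : ℝ) : ℂ)) j z i‖ < ρ) →
          g (Function.update (fun i => ((a i : ℝ) : ℂ)) j z) = f (Function.update (fun i => ((a i : ℝ) : ℂ)) j z)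


/-! ## §1b Rev-5 packages: the measure-level core (stable Lévy scaling) -/

/-- The homogeneous limit density `Ψ_{α,Φ}(y) = Φ(ŷ)·|y|₂^{-(3+α)}` on `ℝ³ ∖ 0` (Lévy density of a symmetric
`α`-stable law with angular profile `Φ`; junk at `y = 0`). -/
def levyDensity (α : ℝ) (Φ : (Fin 3 → ℝ) → ℝ) (y : Fin 3 → ℝ) : ℝ :=
  Φ (fun j => y j / Real.sqrt (∑ l, y l ^ 2)) * Real.sqrt (∑ l, y l ^ 2) ^ (-(3 + α))

/-- `Φ` is an ANGULAR PROFILE: continuous on the Euclidean unit sphere, `≥ 0` there, `> 0` somewhere (as in TAIL). -/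
def IsAngularProfile (Φ : (Fin 3 → ℝ) → ℝ) : Prop :=
  ContinuousOn Φ {u | ∑ i, u i ^ 2 = 1} ∧ (∀ u : Fin 3 → ℝ, ∑ i, u i ^ 2 = 1 → 0 ≤ Φ u) ∧
    ∃ u : Fin 3 → ℝ, ∑ i, u i ^ 2 = 1 ∧ 0 < Φ u

/-- STABLE LÉVY SCALING of `a` with index `α` and angular profile `Φ`: vague convergence of the rescaled jump measures
`R^α Σ_x a(x) δ_{x/R}` on `ℝ³ ∖ 0` to `Ψ_{α,Φ}(y) dy` — for every continuous compactly supported `f` vanishing near `0`,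
`R^α Σ_x a(x) f(x/R) → ∫ f Ψ_{α,Φ}` as `R → ∞` through `ℕ`.  (Same test functions and same `tsum` as `TailMeasuresConverge`.) -/
def HasStableLevyScaling (a : Site 3 → ℝ) (α : ℝ) (Φ : (Fin 3 → ℝ) → ℝ) : Prop :=
  ∀ f : (Fin 3 → ℝ) → ℝ, Continuous f → HasCompactSupport f → (0 : Fin 3 → ℝ) ∉ tsupport f →
    Tendsto (fun R : ℕ => (R : ℝ) ^ α * ∑' x : Site 3, a x * f (fun j => (x j : ℝ) / (R : ℝ)))
      atTop (𝓝 (∫ y, f y * levyDensity α Φ y))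

/-! ## §2 The registered stubs (rev 6: the ONLY `sorry` is the open core `stub_stableLevyScaling`) -/

/-- **STUB 6‴ `stub_stableLevyScaling`** — THE OPEN EXISTENCE CORE in canonical form (EXPANDED; certified
`stub_stableLevyScaling_iff`): under `H` there are `α ∈ (1,2)` and an angular profile `Φ` (continuous on `S²`, `≥ 0`,
`≢ 0`) such that the direct correlation function has stable Lévy scaling with index `α` and profile `Φ`:
`R^α Σ_x dcf(x) f(x/R) → ∫ f(y) Φ(ŷ)|y|₂^{-3-α} dy` for every `f ∈ C_c(ℝ³ ∖ 0)`.  Reading: the step law `q = a/A₀` of the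
walk dictionary is in the domain of normal attraction of a genuinely three-dimensional symmetric `α`-stable law with
continuous angular Lévy density (`α = 2 − η`).  This is where `η(3) > 0` and pure-power scaling live; FALSE for the
Disproof's witnesses `δ₀`, `G₀` (`a = 0` off the unit ball forces the limit `0`, contradicting `Φ ≢ 0`), untouched by any tree
fact (`not_forall_isingEnvelope_localSimonLieb_cruxSchema`), bitten by the card-level barrier rp-cannot-fix-the-scale-log-periodic.
NECESSARY for the crux (`stableLevyScaling_of_crux`).  Crux-sized: to be PROMOTED. -/
theorem stub_stableLevyScaling :
    (∀ A : Finset (Site 3), (Matrix.of fun (p q : ↥A) => criticalTwoPoint 3 (q.1 - p.1)).PosDef ∧ ∀ u v :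
      ↥A, (u ≠ v → (Matrix.of fun (p q : ↥A) => criticalTwoPoint 3 (q.1 - p.1))⁻¹ u v ≤ 0) ∧ 0 ≤ ∑ w,
      (Matrix.of fun (p q : ↥A) => criticalTwoPoint 3 (q.1 - p.1))⁻¹ u w) →
    ∃ (α : ℝ) (Φ : (Fin 3 → ℝ) → ℝ), 1 < α ∧ α < 2 ∧ ContinuousOn Φ {u | ∑ i, u i ^ 2 = 1} ∧
      (∀ u : Fin 3 → ℝ, ∑ i, u i ^ 2 = 1 → 0 ≤ Φ u) ∧ (∃ u : Fin 3 → ℝ, ∑ i, u i ^ 2 = 1 ∧ 0 < Φ u) ∧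
      ∀ f : (Fin 3 → ℝ) → ℝ, Continuous f → HasCompactSupport f → (0 : Fin 3 → ℝ) ∉ tsupport f →
        Filter.Tendsto (fun R : ℕ => (R : ℝ) ^ α * ∑' x : Site 3, (⨅ A : {A : Finset (Site 3) // (0 : Site 3) ∈
          A ∧ x ∈ A}, -((Matrix.of fun (p q : ↥A.1) => criticalTwoPoint 3 (q.1 - p.1))⁻¹ ⟨0, A.2.1⟩ ⟨x, A.2.2⟩)) *
          f (fun j => (x j : ℝ) / (R : ℝ))) Filter.atTop
          (nhds (∫ y : Fin 3 → ℝ, f y * (Φ (fun j => y j / Real.sqrt (∑ l, y l ^ 2)) *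
            Real.sqrt (∑ l, y l ^ 2) ^ (-(3 + α))))) := by
  sorry

/-! STUBS 8–11 ARE LANDED (wave 1 of the continuation lead, 2026-08-16; kernel-checked tree theorems of this namespace,
imported above): `stub_monotoneTauberian` (p124296, file `…MonotoneTauberian`), `stub_slabFunctionalLimit` (p125693,
`…SlabFunctionalLimit` + aux p124305), `stub_axisMarginal` (p124380, `…AxisMarginal`), `stub_scalingOfStableTail` (p124341,
`…ScalingOfStableTail`).  Their registered statements are certified against the packages by the `_iff` lemmas of §3. -/

/-! ## §3 Faithfulness of the expansions of the registered stubs (`Iff.rfl`) -/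

/-- The registered (expanded) statement of `stub_stableLevyScaling` IS
`IsSymmPotentialKernel (criticalTwoPoint 3) → ∃ α Φ, 1 < α ∧ α < 2 ∧ IsAngularProfile Φ ∧ HasStableLevyScaling dcf α Φ`
(definitional unfolding only, up to re-association of the profile conjuncts). -/
theorem stub_stableLevyScaling_iff :
    ((∀ A : Finset (Site 3), (Matrix.of fun (p q : ↥A) => criticalTwoPoint 3 (q.1 - p.1)).PosDef ∧ ∀ u v :
      ↥A, (u ≠ v → (Matrix.of fun (p q : ↥A) => criticalTwoPoint 3 (q.1 - p.1))⁻¹ u v ≤ 0) ∧ 0 ≤ ∑ w,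
      (Matrix.of fun (p q : ↥A) => criticalTwoPoint 3 (q.1 - p.1))⁻¹ u w) →
    ∃ (α : ℝ) (Φ : (Fin 3 → ℝ) → ℝ), 1 < α ∧ α < 2 ∧ ContinuousOn Φ {u | ∑ i, u i ^ 2 = 1} ∧
      (∀ u : Fin 3 → ℝ, ∑ i, u i ^ 2 = 1 → 0 ≤ Φ u) ∧ (∃ u : Fin 3 → ℝ, ∑ i, u i ^ 2 = 1 ∧ 0 < Φ u) ∧
      ∀ f : (Fin 3 → ℝ) → ℝ, Continuous f → HasCompactSupport f → (0 : Fin 3 → ℝ) ∉ tsupport f →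
        Filter.Tendsto (fun R : ℕ => (R : ℝ) ^ α * ∑' x : Site 3, (⨅ A : {A : Finset (Site 3) // (0 : Site 3) ∈
          A ∧ x ∈ A}, -((Matrix.of fun (p q : ↥A.1) => criticalTwoPoint 3 (q.1 - p.1))⁻¹ ⟨0, A.2.1⟩ ⟨x, A.2.2⟩)) *
          f (fun j => (x j : ℝ) / (R : ℝ))) Filter.atTop
          (nhds (∫ y : Fin 3 → ℝ, f y * (Φ (fun j => y j / Real.sqrt (∑ l, y l ^ 2)) *
            Real.sqrt (∑ l, y l ^ 2) ^ (-(3 + α)))))) ↔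
    (IsSymmPotentialKernel (criticalTwoPoint 3) → ∃ (α : ℝ) (Φ : (Fin 3 → ℝ) → ℝ), 1 < α ∧ α < 2 ∧
      ContinuousOn Φ {u | ∑ i, u i ^ 2 = 1} ∧ (∀ u : Fin 3 → ℝ, ∑ i, u i ^ 2 = 1 → 0 ≤ Φ u) ∧
      (∃ u : Fin 3 → ℝ, ∑ i, u i ^ 2 = 1 ∧ 0 < Φ u) ∧ HasStableLevyScaling dcf α Φ) :=
  Iff.rfl

/-- The registered statement of `stub_slabFunctionalLimit`, read in package form: its conclusion is about
`slabSum a i` and its scaling hypothesis is `HasStableLevyScaling`-shaped with a general density `Ψ`. -/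
theorem stub_slabFunctionalLimit_iff :
    (∀ (a : Site 3 → ℝ) (α : ℝ) (Ψ : (Fin 3 → ℝ) → ℝ) (i : Fin 3), 0 < α → (∀ x : Site 3, x ≠ 0 → 0 ≤ a x) →
    Summable a → (∀ x : Site 3, a (-x) = a x) →
    (∀ δ : ℝ, 0 < δ → MeasureTheory.IntegrableOn Ψ {y : Fin 3 → ℝ | δ ≤ ‖y‖}) →
    (∀ f : (Fin 3 → ℝ) → ℝ, Continuous f → HasCompactSupport f → (0 : Fin 3 → ℝ) ∉ tsupport f →
      Filter.Tendsto (fun R : ℕ => (R : ℝ) ^ α * ∑' x : Site 3, a x * f (fun j => (x j : ℝ) / (R : ℝ)))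
        Filter.atTop (nhds (∫ y : Fin 3 → ℝ, f y * Ψ y))) →
    ∀ g : ℝ → ℝ, Continuous g → HasCompactSupport g → tsupport g ⊆ Set.Ioi 0 →
      Filter.Tendsto (fun R : ℕ => (R : ℝ) ^ α * ∑' n : ℕ, (∑' y : Fin 2 → ℤ, a (Fin.insertNth i (n : ℤ) (y) :
        Site 3)) * g ((n : ℝ) / (R : ℝ))) Filter.atTop (nhds ((1 / 2 : ℝ) * ∫ y : Fin 3 → ℝ, g (|y i|) * Ψ y))) ↔
    (∀ (a : Site 3 → ℝ) (α : ℝ) (Ψ : (Fin 3 → ℝ) → ℝ) (i : Fin 3), 0 < α → (∀ x : Site 3, x ≠ 0 → 0 ≤ a x) →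
    Summable a → (∀ x : Site 3, a (-x) = a x) →
    (∀ δ : ℝ, 0 < δ → MeasureTheory.IntegrableOn Ψ {y : Fin 3 → ℝ | δ ≤ ‖y‖}) →
    (∀ f : (Fin 3 → ℝ) → ℝ, Continuous f → HasCompactSupport f → (0 : Fin 3 → ℝ) ∉ tsupport f →
      Filter.Tendsto (fun R : ℕ => (R : ℝ) ^ α * ∑' x : Site 3, a x * f (fun j => (x j : ℝ) / (R : ℝ)))
        Filter.atTop (nhds (∫ y : Fin 3 → ℝ, f y * Ψ y))) →
    ∀ g : ℝ → ℝ, Continuous g → HasCompactSupport g → tsupport g ⊆ Set.Ioi 0 →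
      Filter.Tendsto (fun R : ℕ => (R : ℝ) ^ α * ∑' n : ℕ, slabSum a i n * g ((n : ℝ) / (R : ℝ))) Filter.atTop
        (nhds ((1 / 2 : ℝ) * ∫ y : Fin 3 → ℝ, g (|y i|) * Ψ y))) :=
  Iff.rfl

/-- The registered statement of `stub_axisMarginal`, read in package form (`levyDensity`). -/
theorem stub_axisMarginal_iff :
    (∀ (α : ℝ) (Φ : (Fin 3 → ℝ) → ℝ) (i : Fin 3), 0 < α → ContinuousOn Φ {u : Fin 3 → ℝ | ∑ j, u j ^ 2 = 1} →
    (∀ u : Fin 3 → ℝ, ∑ j, u j ^ 2 = 1 → 0 ≤ Φ u) → (∃ u : Fin 3 → ℝ, ∑ j, u j ^ 2 = 1 ∧ 0 < Φ u) →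
    (∀ δ : ℝ, 0 < δ → MeasureTheory.IntegrableOn (fun y : Fin 3 → ℝ => Φ (fun j => y j / Real.sqrt (∑ l, y l ^ 2)) *
      Real.sqrt (∑ l, y l ^ 2) ^ (-(3 + α))) {y : Fin 3 → ℝ | δ ≤ ‖y‖}) ∧
    ∃ F : ℝ, 0 < F ∧ ∀ g : ℝ → ℝ, Continuous g → HasCompactSupport g → tsupport g ⊆ Set.Ioi 0 →
      ∫ y : Fin 3 → ℝ, g (|y i|) * (Φ (fun j => y j / Real.sqrt (∑ l, y l ^ 2)) * Real.sqrt (∑ l, y l ^ 2) ^ (-(3 + α))) =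
        F * ∫ s in Set.Ioi (0 : ℝ), g s * s ^ (-(1 + α))) ↔
    (∀ (α : ℝ) (Φ : (Fin 3 → ℝ) → ℝ) (i : Fin 3), 0 < α → ContinuousOn Φ {u : Fin 3 → ℝ | ∑ j, u j ^ 2 = 1} →
    (∀ u : Fin 3 → ℝ, ∑ j, u j ^ 2 = 1 → 0 ≤ Φ u) → (∃ u : Fin 3 → ℝ, ∑ j, u j ^ 2 = 1 ∧ 0 < Φ u) →
    (∀ δ : ℝ, 0 < δ → MeasureTheory.IntegrableOn (levyDensity α Φ) {y : Fin 3 → ℝ | δ ≤ ‖y‖}) ∧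
    ∃ F : ℝ, 0 < F ∧ ∀ g : ℝ → ℝ, Continuous g → HasCompactSupport g → tsupport g ⊆ Set.Ioi 0 →
      ∫ y : Fin 3 → ℝ, g (|y i|) * levyDensity α Φ y = F * ∫ s in Set.Ioi (0 : ℝ), g s * s ^ (-(1 + α))) :=
  Iff.rfl

/-- The registered statement of `stub_scalingOfStableTail`, read in package form: a stable tail with data `(η, Φ)` gives
`HasStableLevyScaling a (2 - η) Φ` once `-(5 - η)` is read as `-(3 + (2 - η))` (done in `hasStableLevyScaling_of_stableTail`). -/
example : levyDensity = fun (α : ℝ) (Φ : (Fin 3 → ℝ) → ℝ) (y : Fin 3 → ℝ) =>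
    Φ (fun j => y j / Real.sqrt (∑ l, y l ^ 2)) * Real.sqrt (∑ l, y l ^ 2) ^ (-(3 + α)) := rfl

/-- The registered (expanded) statement of `stub_crossLemma` IS `CrossLemma`. -/
theorem stub_crossLemma_iff :
    ((∃ ρ : ℝ, 0 < ρ ∧ ∀ (f : (Fin 3 → ℂ) → ℂ) (M : ℝ), (∀ (j : Fin 3) (a : Fin 3 → ℝ), (∀ i, |a i| ≤ 1) → DifferentiableOn ℂ (fun z : ℂ => f (Function.update (fun i => ((a i : ℝ) : ℂ)) j z)) (Metric.ball (0 : ℂ) 2)) → (∀ (j : Fin 3) (a : Fin 3 → ℝ) (z : ℂ), (∀ i, |a i| ≤ 1) → ‖z‖ < 2 → ‖f (Function.update (fun i => ((a i : ℝ) : ℂ)) j z)‖ ≤ M) → ∃ g : (Fin 3 → ℂ) → ℂ, AnalyticOnNhd ℂ g {z | ∀ i, ‖z i‖ < ρ} ∧ (∀ z : Fin 3 → ℂ, (∀ i, ‖z i‖ < ρ) → ‖g z‖ ≤ M) ∧ ∀ (j : Fin 3) (a : Fin 3 → ℝ) (z : ℂ), (∀ i, |a i| ≤ 1) → ‖z‖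 < 2 → (∀ i, ‖Function.update (fun i => ((a i : ℝ) : ℂ)) j z i‖ < ρ) → g (Function.update (fun i => ((a i : ℝ) : ℂ)) j z) = f (Function.update (fun i => ((a i : ℝ) : ℂ)) j z))) ↔
    CrossLemma :=
  Iff.rfl

/-- The expanded a-side decay statement (conclusion of the landed `stub_slabModeExpDecay_auxGreenTransfer`) IS
`HasSlabModeExpDecay dcf`. -/
theorem hasSlabModeExpDecay_dcf_iff :
    ((∃ c : ℝ, 0 < c ∧ ∀ (i : Fin 3) (k : Fin 2 → ℝ), (∀ j, |k j| ≤ Real.pi) → ∀ c' : ℝ, 0 < c' → c' < c → ∃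
      C : ℝ, ∀ᶠ n : ℕ in Filter.atTop, (∑' y : Fin 2 → ℤ, (⨅ A : {A : Finset (Site 3) // (0 : Site 3) ∈ A ∧
      (Fin.insertNth i (n : ℤ) (y) : Site 3) ∈ A}, -((Matrix.of fun (p q : ↥A.1) => criticalTwoPoint 3 (q.1
      - p.1))⁻¹ ⟨0, A.2.1⟩ ⟨(Fin.insertNth i (n : ℤ) (y) : Site 3), A.2.2⟩)) * Real.cos (∑ j, k j * (y j :
      ℝ))) ≤ C * Real.exp (-(c' * ‖k‖ * (n : ℝ))))) ↔
    HasSlabModeExpDecay dcf :=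
  Iff.rfl

/-- The rev-4 core statement (registered signature of the retired stub `stub_tailRegularVariation` = the hypothesis of the landed closure `stub_closureModuloCore`, p121716) IS `IsSymmPotentialKernel (criticalTwoPoint 3) → Summable dcf → IsSlabHausdorff dcf → HasTransverseGap dcf → ∃ η c : ℝ, 0 < η ∧ η < 1 ∧ 0 < c ∧ HasRadialAsymptotics dcf η c ∧ TailMeasuresConverge dcf η`. -/
theorem stub_tailRegularVariation_iff :
    ((∀ A : Finset (Site 3), (Matrix.of fun (p q : ↥A) => criticalTwoPoint 3 (q.1 - p.1)).PosDef ∧ ∀ u v :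
      ↥A, (u ≠ v → (Matrix.of fun (p q : ↥A) => criticalTwoPoint 3 (q.1 - p.1))⁻¹ u v ≤ 0) ∧ 0 ≤ ∑ w,
      (Matrix.of fun (p q : ↥A) => criticalTwoPoint 3 (q.1 - p.1))⁻¹ u w) →
    Summable (fun x : Site 3 => (⨅ A : {A : Finset (Site 3) // (0 : Site 3) ∈ A ∧ x ∈ A}, -((Matrix.of fun
      (p q : ↥A.1) => criticalTwoPoint 3 (q.1 - p.1))⁻¹ ⟨0, A.2.1⟩ ⟨x, A.2.2⟩))) →
    (∀ (i : Fin 3) (k : Fin 2 → ℝ), ∃ τ : MeasureTheory.Measure ℝ, MeasureTheory.IsFiniteMeasure τ ∧ τ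
      (Set.Icc (0 : ℝ) 1)ᶜ = 0 ∧ ∀ n : ℕ, 1 ≤ n → (∑' y : Fin 2 → ℤ, (⨅ A : {A : Finset (Site 3) // (0 :
      Site 3) ∈ A ∧ (Fin.insertNth i (n : ℤ) (y) : Site 3) ∈ A}, -((Matrix.of fun (p q : ↥A.1) =>
      criticalTwoPoint 3 (q.1 - p.1))⁻¹ ⟨0, A.2.1⟩ ⟨(Fin.insertNth i (n : ℤ) (y) : Site 3), A.2.2⟩)) *
      Real.cos (∑ j, k j * (y j : ℝ))) = ∫ t, t ^ (n - 1) ∂τ) →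
    (∃ c : ℝ, 0 < c ∧ ∀ (i : Fin 3) (k : Fin 2 → ℝ), (∀ j, |k j| ≤ Real.pi) → ∀ n : ℕ, 1 ≤ n → (∑' y : Fin
      2 → ℤ, (⨅ A : {A : Finset (Site 3) // (0 : Site 3) ∈ A ∧ (Fin.insertNth i ((n + 1 : ℕ) : ℤ) (y) :
      Site 3) ∈ A}, -((Matrix.of fun (p q : ↥A.1) => criticalTwoPoint 3 (q.1 - p.1))⁻¹ ⟨0, A.2.1⟩
      ⟨(Fin.insertNth i ((n + 1 : ℕ) : ℤ) (y) : Site 3), A.2.2⟩)) * Real.cos (∑ j, k j * (y j : ℝ))) ≤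
      Real.exp (-(c * ‖k‖)) * (∑' y : Fin 2 → ℤ, (⨅ A : {A : Finset (Site 3) // (0 : Site 3) ∈ A ∧
      (Fin.insertNth i (n : ℤ) (y) : Site 3) ∈ A}, -((Matrix.of fun (p q : ↥A.1) => criticalTwoPoint 3 (q.1
      - p.1))⁻¹ ⟨0, A.2.1⟩ ⟨(Fin.insertNth i (n : ℤ) (y) : Site 3), A.2.2⟩)) * Real.cos (∑ j, k j * (y j :
      ℝ)))) →
    ∃ η c : ℝ, 0 < η ∧ η < 1 ∧ 0 < c ∧
    (∀ i : Fin 3, Filter.Tendsto (fun n : ℕ => (∑' y : Fin 2 → ℤ, (⨅ A : {A : Finset (Site 3) // (0 : Site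
      3) ∈ A ∧ (Fin.insertNth i (n : ℤ) (y) : Site 3) ∈ A}, -((Matrix.of fun (p q : ↥A.1) =>
      criticalTwoPoint 3 (q.1 - p.1))⁻¹ ⟨0, A.2.1⟩ ⟨(Fin.insertNth i (n : ℤ) (y) : Site 3), A.2.2⟩))) * (n
      : ℝ) ^ (3 - η)) Filter.atTop (nhds c)) ∧
    (∀ f : (Fin 3 → ℝ) → ℝ, Continuous f → HasCompactSupport f → (0 : Fin 3 → ℝ) ∉ tsupport f → ∃ L : ℝ,
      Filter.Tendsto (fun R : ℕ => (R : ℝ) ^ (2 - η) * ∑' x : Site 3, (⨅ A : {A : Finset (Site 3) // (0 :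
      Site 3) ∈ A ∧ x ∈ A}, -((Matrix.of fun (p q : ↥A.1) => criticalTwoPoint 3 (q.1 - p.1))⁻¹ ⟨0, A.2.1⟩
      ⟨x, A.2.2⟩)) * f (fun j => (x j : ℝ) / (R : ℝ))) Filter.atTop (nhds L))) ↔
    (IsSymmPotentialKernel (criticalTwoPoint 3) → Summable dcf → IsSlabHausdorff dcf → HasTransverseGap dcf → ∃ η c : ℝ, 0 < η ∧ η < 1 ∧ 0 < c ∧ HasRadialAsymptotics dcf η c ∧ TailMeasuresConverge dcf η) :=
  Iff.rfl

/-! ## §3b Faithfulness of the LANDED stubs' registered statements (`Iff.rfl`; the theorems themselves are imported) -/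

/-- Faithfulness of the expansion: the registered statement of `stub_slabSpectralRepresentation` IS
`HasSlabSpectralRepresentation (criticalTwoPoint 3)` (definitional unfolding only). -/
theorem stub_slabSpectralRepresentation_iff :
    ((∀ (i : Fin 3) (s : Finset (Fin 2 → ℤ)) (v : (Fin 2 → ℤ) → ℝ), ∃ μ : MeasureTheory.Measure ℝ,
      MeasureTheory.IsFiniteMeasure μ ∧ μ (Set.Icc (0 : ℝ) 1)ᶜ = 0 ∧ ∀ n : ℕ, ∑ x ∈ s, ∑ y ∈ s, v x * v y *
      criticalTwoPoint 3 (Fin.insertNth i (n : ℤ) (x - y) : Site 3) = ∫ t, t ^ n ∂μ)) ↔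
    (HasSlabSpectralRepresentation (criticalTwoPoint 3)) :=
  Iff.rfl

/-- Faithfulness of the expansion: the registered statement of `stub_dcfStructure` IS
`IsSymmPotentialKernel (criticalTwoPoint 3) → Summable dcf ∧ IsHyperoctahedralInvariant dcf` (definitional unfolding only). -/
theorem stub_dcfStructure_iff :
    ((∀ A : Finset (Site 3), (Matrix.of fun (p q : ↥A) => criticalTwoPoint 3 (q.1 - p.1)).PosDef ∧ ∀ u v :
      ↥A, (u ≠ v → (Matrix.of fun (p q : ↥A) => criticalTwoPoint 3 (q.1 - p.1))⁻¹ u v ≤ 0) ∧ 0 ≤ ∑ w,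
      (Matrix.of fun (p q : ↥A) => criticalTwoPoint 3 (q.1 - p.1))⁻¹ u w) →
    Summable (fun x : Site 3 => (⨅ A : {A : Finset (Site 3) // (0 : Site 3) ∈ A ∧ x ∈ A}, -((Matrix.of fun
      (p q : ↥A.1) => criticalTwoPoint 3 (q.1 - p.1))⁻¹ ⟨0, A.2.1⟩ ⟨x, A.2.2⟩))) ∧
    ((∀ (σ : Equiv.Perm (Fin 3)) (x : Site 3), (⨅ A : {A : Finset (Site 3) // (0 : Site 3) ∈ A ∧ (fun j =>
      x (σ j)) ∈ A}, -((Matrix.of fun (p q : ↥A.1) => criticalTwoPoint 3 (q.1 - p.1))⁻¹ ⟨0, A.2.1⟩ ⟨(fun j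
      => x (σ j)), A.2.2⟩)) = (⨅ A : {A : Finset (Site 3) // (0 : Site 3) ∈ A ∧ x ∈ A}, -((Matrix.of fun (p
      q : ↥A.1) => criticalTwoPoint 3 (q.1 - p.1))⁻¹ ⟨0, A.2.1⟩ ⟨x, A.2.2⟩))) ∧ ∀ (j : Fin 3) (x : Site 3),
      (⨅ A : {A : Finset (Site 3) // (0 : Site 3) ∈ A ∧ (Function.update x j (-x j)) ∈ A}, -((Matrix.of fun
      (p q : ↥A.1) => criticalTwoPoint 3 (q.1 - p.1))⁻¹ ⟨0, A.2.1⟩ ⟨(Function.update x j (-x j)), A.2.2⟩))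
      = (⨅ A : {A : Finset (Site 3) // (0 : Site 3) ∈ A ∧ x ∈ A}, -((Matrix.of fun (p q : ↥A.1) =>
      criticalTwoPoint 3 (q.1 - p.1))⁻¹ ⟨0, A.2.1⟩ ⟨x, A.2.2⟩)))) ↔
    (IsSymmPotentialKernel (criticalTwoPoint 3) → Summable dcf ∧ IsHyperoctahedralInvariant dcf) :=
  Iff.rfl

/-- Faithfulness of the expansion: the registered statement of `stub_pickInversion` IS
`IsSymmPotentialKernel (criticalTwoPoint 3) → Summable dcf → HasSlabSpectralRepresentation (criticalTwoPoint 3) → IsSlabHausdorff dcf` (definitional unfolding only). -/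
theorem stub_pickInversion_iff :
    ((∀ A : Finset (Site 3), (Matrix.of fun (p q : ↥A) => criticalTwoPoint 3 (q.1 - p.1)).PosDef ∧ ∀ u v :
      ↥A, (u ≠ v → (Matrix.of fun (p q : ↥A) => criticalTwoPoint 3 (q.1 - p.1))⁻¹ u v ≤ 0) ∧ 0 ≤ ∑ w,
      (Matrix.of fun (p q : ↥A) => criticalTwoPoint 3 (q.1 - p.1))⁻¹ u w) →
    Summable (fun x : Site 3 => (⨅ A : {A : Finset (Site 3) // (0 : Site 3) ∈ A ∧ x ∈ A}, -((Matrix.of fun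
      (p q : ↥A.1) => criticalTwoPoint 3 (q.1 - p.1))⁻¹ ⟨0, A.2.1⟩ ⟨x, A.2.2⟩))) →
    (∀ (i : Fin 3) (s : Finset (Fin 2 → ℤ)) (v : (Fin 2 → ℤ) → ℝ), ∃ μ : MeasureTheory.Measure ℝ,
      MeasureTheory.IsFiniteMeasure μ ∧ μ (Set.Icc (0 : ℝ) 1)ᶜ = 0 ∧ ∀ n : ℕ, ∑ x ∈ s, ∑ y ∈ s, v x * v y *
      criticalTwoPoint 3 (Fin.insertNth i (n : ℤ) (x - y) : Site 3) = ∫ t, t ^ n ∂μ) →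
    (∀ (i : Fin 3) (k : Fin 2 → ℝ), ∃ τ : MeasureTheory.Measure ℝ, MeasureTheory.IsFiniteMeasure τ ∧ τ
      (Set.Icc (0 : ℝ) 1)ᶜ = 0 ∧ ∀ n : ℕ, 1 ≤ n → (∑' y : Fin 2 → ℤ, (⨅ A : {A : Finset (Site 3) // (0 :
      Site 3) ∈ A ∧ (Fin.insertNth i (n : ℤ) (y) : Site 3) ∈ A}, -((Matrix.of fun (p q : ↥A.1) =>
      criticalTwoPoint 3 (q.1 - p.1))⁻¹ ⟨0, A.2.1⟩ ⟨(Fin.insertNth i (n : ℤ) (y) : Site 3), A.2.2⟩)) *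
      Real.cos (∑ j, k j * (y j : ℝ))) = ∫ t, t ^ (n - 1) ∂τ)) ↔
    (IsSymmPotentialKernel (criticalTwoPoint 3) → Summable dcf → HasSlabSpectralRepresentation (criticalTwoPoint 3) → IsSlabHausdorff dcf) :=
  Iff.rfl

/-- Faithfulness of the expansion: the registered statement of `stub_scaleRegularity` IS
`∀ (a : Site 3 → ℝ) (η c : ℝ), (∀ x, x ≠ 0 → 0 ≤ a x) → IsHyperoctahedralInvariant a → IsSlabHausdorff a → HasTransverseGap a → 0 < η → η < 1 → 0 < c → HasRadialAsymptotics a η c → IsRegularAtScale a η` (definitional unfolding only). -/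
theorem stub_scaleRegularity_iff :
    (∀ (a : Site 3 → ℝ) (η c : ℝ), (∀ x : Site 3, x ≠ 0 → 0 ≤ a x) →
    ((∀ (σ : Equiv.Perm (Fin 3)) (x : Site 3), a (fun j => x (σ j)) = a x) ∧ ∀ (j : Fin 3) (x : Site 3), a
      (Function.update x j (-x j)) = a x) →
    (∀ (i : Fin 3) (k : Fin 2 → ℝ), ∃ τ : MeasureTheory.Measure ℝ, MeasureTheory.IsFiniteMeasure τ ∧ τ
      (Set.Icc (0 : ℝ) 1)ᶜ = 0 ∧ ∀ n : ℕ, 1 ≤ n → (∑' y : Fin 2 → ℤ, a (Fin.insertNth i (n : ℤ) (y) : Site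
      3) * Real.cos (∑ j, k j * (y j : ℝ))) = ∫ t, t ^ (n - 1) ∂τ) →
    (∃ c : ℝ, 0 < c ∧ ∀ (i : Fin 3) (k : Fin 2 → ℝ), (∀ j, |k j| ≤ Real.pi) → ∀ n : ℕ, 1 ≤ n → (∑' y : Fin
      2 → ℤ, a (Fin.insertNth i ((n + 1 : ℕ) : ℤ) (y) : Site 3) * Real.cos (∑ j, k j * (y j : ℝ))) ≤
      Real.exp (-(c * ‖k‖)) * (∑' y : Fin 2 → ℤ, a (Fin.insertNth i (n : ℤ) (y) : Site 3) * Real.cos (∑ j,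
      k j * (y j : ℝ)))) →
    0 < η → η < 1 → 0 < c →
    (∀ i : Fin 3, Filter.Tendsto (fun n : ℕ => (∑' y : Fin 2 → ℤ, a (Fin.insertNth i (n : ℤ) (y) : Site 3))
      * (n : ℝ) ^ (3 - η)) Filter.atTop (nhds c)) →
    ((∃ C : ℝ, ∀ x : Site 3, x ≠ 0 → a x * Real.sqrt (∑ j, ((x) j : ℝ) ^ 2) ^ (5 - η) ≤ C) ∧ (∀ ε : ℝ, 0 <
      ε → ∃ δ : ℝ, 0 < δ ∧ ∃ R₀ : ℝ, ∀ x y : Site 3, R₀ ≤ Real.sqrt (∑ j, ((x) j : ℝ) ^ 2) → Real.sqrt (∑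
      j, ((x - y) j : ℝ) ^ 2) ≤ δ * Real.sqrt (∑ j, ((x) j : ℝ) ^ 2) → |a x * Real.sqrt (∑ j, ((x) j : ℝ) ^
      2) ^ (5 - η) - a y * Real.sqrt (∑ j, ((y) j : ℝ) ^ 2) ^ (5 - η)| ≤ ε) ∧ (∀ ε : ℝ, 0 < ε → ∃ K : ℝ, 0
      < K ∧ ∃ N₀ : ℕ, ∀ (i : Fin 3) (n : ℕ), N₀ ≤ n → (∑' y : Fin 2 → ℤ, if K * (n : ℝ) < ‖y‖ then a
      (Fin.insertNth i (n : ℤ) (y) : Site 3) else 0) ≤ ε * (∑' y : Fin 2 → ℤ, a (Fin.insertNth i (n : ℤ)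
      (y) : Site 3))))) ↔
    (∀ (a : Site 3 → ℝ) (η c : ℝ), (∀ x, x ≠ 0 → 0 ≤ a x) → IsHyperoctahedralInvariant a → IsSlabHausdorff a → HasTransverseGap a → 0 < η → η < 1 → 0 < c → HasRadialAsymptotics a η c → IsRegularAtScale a η) :=
  Iff.rfl

/-- Faithfulness of the expansion: the registered statement of `stub_pointwiseUpgrade` IS
`∀ (a : Site 3 → ℝ) (η c : ℝ), (∀ x, x ≠ 0 → 0 ≤ a x) → 0 < η → η < 1 → 0 < c → HasRadialAsymptotics a η c → IsRegularAtScale a η → TailMeasuresConverge a η → HasStableTail a` (definitional unfolding only). -/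
theorem stub_pointwiseUpgrade_iff :
    (∀ (a : Site 3 → ℝ) (η c : ℝ), (∀ x : Site 3, x ≠ 0 → 0 ≤ a x) →
    0 < η → η < 1 → 0 < c →
    (∀ i : Fin 3, Filter.Tendsto (fun n : ℕ => (∑' y : Fin 2 → ℤ, a (Fin.insertNth i (n : ℤ) (y) : Site 3))
      * (n : ℝ) ^ (3 - η)) Filter.atTop (nhds c)) →
    ((∃ C : ℝ, ∀ x : Site 3, x ≠ 0 → a x * Real.sqrt (∑ j, ((x) j : ℝ) ^ 2) ^ (5 - η) ≤ C) ∧ (∀ ε : ℝ, 0 <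
      ε → ∃ δ : ℝ, 0 < δ ∧ ∃ R₀ : ℝ, ∀ x y : Site 3, R₀ ≤ Real.sqrt (∑ j, ((x) j : ℝ) ^ 2) → Real.sqrt (∑
      j, ((x - y) j : ℝ) ^ 2) ≤ δ * Real.sqrt (∑ j, ((x) j : ℝ) ^ 2) → |a x * Real.sqrt (∑ j, ((x) j : ℝ) ^
      2) ^ (5 - η) - a y * Real.sqrt (∑ j, ((y) j : ℝ) ^ 2) ^ (5 - η)| ≤ ε) ∧ (∀ ε : ℝ, 0 < ε → ∃ K : ℝ, 0
      < K ∧ ∃ N₀ : ℕ, ∀ (i : Fin 3) (n : ℕ), N₀ ≤ n → (∑' y : Fin 2 → ℤ, if K * (n : ℝ) < ‖y‖ then a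
      (Fin.insertNth i (n : ℤ) (y) : Site 3) else 0) ≤ ε * (∑' y : Fin 2 → ℤ, a (Fin.insertNth i (n : ℤ)
      (y) : Site 3)))) →
    (∀ f : (Fin 3 → ℝ) → ℝ, Continuous f → HasCompactSupport f → (0 : Fin 3 → ℝ) ∉ tsupport f → ∃ L : ℝ,
      Filter.Tendsto (fun R : ℕ => (R : ℝ) ^ (2 - η) * ∑' x : Site 3, a x * f (fun j => (x j : ℝ) / (R :
      ℝ))) Filter.atTop (nhds L)) →
    (∃ (η : ℝ) (Φ : (Fin 3 → ℝ) → ℝ), 0 < η ∧ η < 1 ∧ ContinuousOn Φ {u | ∑ i, u i ^ 2 = 1} ∧ (∀ u : Fin 3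
      → ℝ, ∑ i, u i ^ 2 = 1 → 0 ≤ Φ u) ∧ (∃ u : Fin 3 → ℝ, ∑ i, u i ^ 2 = 1 ∧ 0 < Φ u) ∧ Filter.Tendsto
      (fun x : Site 3 => a x * Real.sqrt (∑ j, ((x) j : ℝ) ^ 2) ^ (5 - η) - Φ (fun i => (x i : ℝ) /
      Real.sqrt (∑ j, ((x) j : ℝ) ^ 2))) Filter.cofinite (nhds 0))) ↔
    (∀ (a : Site 3 → ℝ) (η c : ℝ), (∀ x, x ≠ 0 → 0 ≤ a x) → 0 < η → η < 1 → 0 < c → HasRadialAsymptotics a η c → IsRegularAtScale a η → TailMeasuresConverge a η → HasStableTail a) :=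
  Iff.rfl

/-! ## §4 Sorry-free glue used by the composition -/

/-- Under `H` every term of the infimum defining `directCorr G x`, `x ≠ 0`, is nonnegative, hence so is the
infimum (the positivity half of "the precision operator is a Laplacian"). -/
theorem directCorr_nonneg_of_isSymmPotentialKernel {G : Site 3 → ℝ} (h : IsSymmPotentialKernel G)
    {x : Site 3} (hx : x ≠ 0) : 0 ≤ directCorr G x := by
  haveI : Nonempty {A : Finset (Site 3) // (0 : Site 3) ∈ A ∧ x ∈ A} := ⟨⟨{0, x}, by simp, by simp⟩⟩
  refine le_ciInf fun A => ?_
  exact neg_nonneg.2 (((h A.1).2 _ _).1 fun e => hx (Subtype.ext_iff.mp e).symm)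

/-- Glue (package form): Hausdorff slab modes with eventual exponential decay at rate `c‖k‖` have the linear
transverse gap with the same constant — the tree theorem `transverseGap_of_hausdorff_of_eventually_expDecay`
(file `…LinearTransverseGapAux`, p102959; rigidity of Hausdorff moment sequences). -/
theorem hasTransverseGap_of_isSlabHausdorff_of_hasSlabModeExpDecay (a : Site 3 → ℝ)
    (hHaus : IsSlabHausdorff a) (hdec : HasSlabModeExpDecay a) : HasTransverseGap a := by
  obtain ⟨c, hc, hdec⟩ := hdec
  exact ⟨c, hc, transverseGap_of_hausdorff_of_eventually_expDecay a hHaus c hdec⟩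

/-- Nine-frame LINE HOLOMORPHY of the Green symbol from its axis and diagonal halves (the landed
`stub_slabModeExpDecay_auxAxisLineHol`, `stub_slabModeExpDecay_auxDiagLineHol`): take the smaller radius constant and
the larger bound. -/
theorem lineHol_nine_of_halves :
    (∀ A : Finset (Site 3), (Matrix.of fun (p q : ↥A) => criticalTwoPoint 3 (q.1 - p.1)).PosDef ∧ ∀ u v :
      ↥A, (u ≠ v → (Matrix.of fun (p q : ↥A) => criticalTwoPoint 3 (q.1 - p.1))⁻¹ u v ≤ 0) ∧ 0 ≤ ∑ w,
      (Matrix.of fun (p q : ↥A) => criticalTwoPoint 3 (q.1 - p.1))⁻¹ u w) →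
    ∀ A₀ : ℝ, Filter.Tendsto (fun n : ℕ => (Matrix.of fun (p q : ↥(box 3 n)) => criticalTwoPoint 3 (q.1 - p.1))⁻¹
        ⟨0, zero_mem_box 3 n⟩ ⟨0, zero_mem_box 3 n⟩) Filter.atTop (nhds A₀) →
      (∀ n : ℕ, (Matrix.of fun (p q : ↥(box 3 n)) => criticalTwoPoint 3 (q.1 - p.1))⁻¹
        ⟨0, zero_mem_box 3 n⟩ ⟨0, zero_mem_box 3 n⟩ ≤ A₀) → 0 < A₀ →
    (∃ c₀ : ℝ, 0 < c₀ ∧ ∀ (d m : ℝ), 0 < d → 0 < m → ∃ B : ℝ,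
      ∀ u : Site 3, (∃ i : Fin 3, u = Pi.single i 1) →
      ∀ p : Fin 3 → ℝ, (∀ n : ℤ, d ≤ |(∑ j, p j * (u j : ℝ)) - 2 * Real.pi * n|) →
        (∀ (t : ℝ) (L : Fin 3 → ℤ), m ≤ ‖(fun j => p j + t * ((u j : ℝ) / ∑ l, ((u l : ℝ)) ^ 2)
          - 2 * Real.pi * (L j : ℝ))‖) →
        ∃ F : ℂ → ℂ, DifferentiableOn ℂ F (Metric.ball (0 : ℂ) (c₀ * d)) ∧
          (∀ s : ℝ, |s| < c₀ * d →
            F (s : ℂ) = (((1 - ∑' x : Site 3, (if x = 0 then (0 : ℝ) else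
              (⨅ A : {A : Finset (Site 3) // (0 : Site 3) ∈ A ∧ x ∈ A}, -((Matrix.of fun (p q : ↥A.1) =>
                criticalTwoPoint 3 (q.1 - p.1))⁻¹ ⟨0, A.2.1⟩ ⟨x, A.2.2⟩))) / A₀ *
              Real.cos (∑ j, (p j + s * ((u j : ℝ) / ∑ l, ((u l : ℝ)) ^ 2)) * ((x j : ℤ) : ℝ)))⁻¹ : ℝ) : ℂ)) ∧
          (∀ z : ℂ, ‖z‖ < c₀ * d → ‖F z‖ ≤ B)) →
    (∃ c₀ : ℝ, 0 < c₀ ∧ ∀ (d m : ℝ), 0 < d → 0 < m → ∃ B : ℝ,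
      ∀ u : Site 3, (∃ i j : Fin 3, i ≠ j ∧ (u = Pi.single i 1 + Pi.single j 1 ∨ u = Pi.single i 1 - Pi.single j 1)) →
      ∀ p : Fin 3 → ℝ, (∀ n : ℤ, d ≤ |(∑ j, p j * (u j : ℝ)) - 2 * Real.pi * n|) →
        (∀ (t : ℝ) (L : Fin 3 → ℤ), m ≤ ‖(fun j => p j + t * ((u j : ℝ) / ∑ l, ((u l : ℝ)) ^ 2)
          - 2 * Real.pi * (L j : ℝ))‖) →
        ∃ F : ℂ → ℂ, DifferentiableOn ℂ F (Metric.ball (0 : ℂ) (c₀ * d)) ∧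
          (∀ s : ℝ, |s| < c₀ * d →
            F (s : ℂ) = (((1 - ∑' x : Site 3, (if x = 0 then (0 : ℝ) else
              (⨅ A : {A : Finset (Site 3) // (0 : Site 3) ∈ A ∧ x ∈ A}, -((Matrix.of fun (p q : ↥A.1) =>
                criticalTwoPoint 3 (q.1 - p.1))⁻¹ ⟨0, A.2.1⟩ ⟨x, A.2.2⟩))) / A₀ *
              Real.cos (∑ j, (p j + s * ((u j : ℝ) / ∑ l, ((u l : ℝ)) ^ 2)) * ((x j : ℤ) : ℝ)))⁻¹ : ℝ) : ℂ)) ∧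
          (∀ z : ℂ, ‖z‖ < c₀ * d → ‖F z‖ ≤ B)) →
    ∃ c₀ : ℝ, 0 < c₀ ∧ ∀ (d m : ℝ), 0 < d → 0 < m → ∃ B : ℝ,
      ∀ u : Site 3, ((∃ i : Fin 3, u = Pi.single i 1) ∨
          ∃ i j : Fin 3, i ≠ j ∧ (u = Pi.single i 1 + Pi.single j 1 ∨ u = Pi.single i 1 - Pi.single j 1)) →
      ∀ p : Fin 3 → ℝ, (∀ n : ℤ, d ≤ |(∑ j, p j * (u j : ℝ)) - 2 * Real.pi * n|) →
        (∀ (t : ℝ) (L : Fin 3 → ℤ), m ≤ ‖(fun j => p j + t * ((u j : ℝ) / ∑ l, ((u l : ℝ)) ^ 2)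
          - 2 * Real.pi * (L j : ℝ))‖) →
        ∃ F : ℂ → ℂ, DifferentiableOn ℂ F (Metric.ball (0 : ℂ) (c₀ * d)) ∧
          (∀ s : ℝ, |s| < c₀ * d →
            F (s : ℂ) = (((1 - ∑' x : Site 3, (if x = 0 then (0 : ℝ) else
              (⨅ A : {A : Finset (Site 3) // (0 : Site 3) ∈ A ∧ x ∈ A}, -((Matrix.of fun (p q : ↥A.1) =>
                criticalTwoPoint 3 (q.1 - p.1))⁻¹ ⟨0, A.2.1⟩ ⟨x, A.2.2⟩))) / A₀ *
              Real.cos (∑ j, (p j + s * ((u j : ℝ) / ∑ l, ((u l : ℝ)) ^ 2)) * ((x j : ℤ) : ℝ)))⁻¹ : ℝ) : ℂ)) ∧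
          (∀ z : ℂ, ‖z‖ < c₀ * d → ‖F z‖ ≤ B) := by
  intro _ A₀ _ _ _ hax hdg
  obtain ⟨ca, hca, hax⟩ := hax
  obtain ⟨cd, hcd, hdg⟩ := hdg
  refine ⟨min ca cd, lt_min hca hcd, fun d m hd hm => ?_⟩
  obtain ⟨Ba, hBa⟩ := hax d m hd hm
  obtain ⟨Bd, hBd⟩ := hdg d m hd hm
  refine ⟨max Ba Bd, fun u hu p hp hline => ?_⟩
  have hmono_a : min ca cd * d ≤ ca * d := mul_le_mul_of_nonneg_right (min_le_left _ _) hd.le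
  have hmono_d : min ca cd * d ≤ cd * d := mul_le_mul_of_nonneg_right (min_le_right _ _) hd.le
  rcases hu with hu | hu
  · obtain ⟨F, hF, htr, hbd⟩ := hBa u hu p hp hline
    refine ⟨F, hF.mono (Metric.ball_subset_ball hmono_a), fun s hs => htr s (lt_of_lt_of_le hs hmono_a),
      fun z hz => (hbd z (lt_of_lt_of_le hz hmono_a)).trans (le_max_left _ _)⟩
  · obtain ⟨F, hF, htr, hbd⟩ := hBd u hu p hp hline
    refine ⟨F, hF.mono (Metric.ball_subset_ball hmono_d), fun s hs => htr s (lt_of_lt_of_le hs hmono_d),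
      fun z hz => (hbd z (lt_of_lt_of_le hz hmono_d)).trans (le_max_right _ _)⟩

/-- **The transverse mass gap from the cross theorem** (rev 3 glue, sorry-free): `CrossLemma → H →
HasSlabModeExpDecay dcf`.  Chain: the `A₀`-data of the walk dictionary (`EtaBoundsTransfer.exists_A0`); line
holomorphy in the nine frames (`lineHol_nine_of_halves` of the two landed halves); the cross assembly
(`stub_slabModeExpDecay_auxCrossAssembly`) gives the G-side decay `HypG` at this `A₀`; uniqueness of limits makes it the
`∀ A₀`-form; the lossless transfer (`stub_slabModeExpDecay_auxGreenTransfer`) gives the a-side decay. -/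
theorem hasSlabModeExpDecay_dcf_of_crossLemma (hCross : CrossLemma) (hH : IsSymmPotentialKernel (criticalTwoPoint 3)) :
    HasSlabModeExpDecay dcf := by
  obtain ⟨A₀, hT, hle, hpos⟩ := Summit.CriticalPhenomena.Ising3DConformalLimit.Theorems.EtaBoundsTransfer.exists_A0
    (d := 3) (G := criticalTwoPoint 3)
    (M := fun A : Finset (Site 3) => Matrix.of fun (p q : ↥A) => criticalTwoPoint 3 (q.1 - p.1))
    (k := fun n : ℕ => (Matrix.of fun (p q : ↥(box 3 n)) => criticalTwoPoint 3 (q.1 - p.1))⁻¹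
      ⟨0, zero_mem_box 3 n⟩ ⟨0, zero_mem_box 3 n⟩)
    (fun _ => rfl) hH criticalTwoPoint_tendsto_zero_cofinite (fun _ => rfl)
  have hLH := lineHol_nine_of_halves hH A₀ hT hle hpos (stub_slabModeExpDecay_auxAxisLineHol hH A₀ hT hle hpos)
    (stub_slabModeExpDecay_auxDiagLineHol hH A₀ hT hle hpos)
  obtain ⟨c, hc, hdec⟩ := stub_slabModeExpDecay_auxCrossAssembly hH A₀ hT hle hpos hLH hCross
  refine hasSlabModeExpDecay_dcf_iff.mp (stub_slabModeExpDecay_auxGreenTransfer hH ⟨c, hc, ?_⟩)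
  intro A₀' hT' hle' hpos'
  have hA : A₀' = A₀ := tendsto_nhds_unique hT' hT
  subst hA
  exact hdec


/-! ## §4b Rev-5 glue (sorry-free): from stable Lévy scaling to the rev-4 core -/

/-- Sign-flip invariance in the three coordinates gives evenness `a(−x) = a(x)`. -/
theorem even_of_isHyperoctahedralInvariant {a : Site 3 → ℝ} (h : IsHyperoctahedralInvariant a) (x : Site 3) :
    a (-x) = a x := by
  have key : -x = Function.update (Function.update (Function.update x 0 (-x 0)) 1
      (-(Function.update x 0 (-x 0)) 1)) 2
      (-(Function.update (Function.update x 0 (-x 0)) 1 (-(Function.update x 0 (-x 0)) 1)) 2) := by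
    ext j
    fin_cases j <;> simp [Function.update]
  rw [key, h.2 2, h.2 1, h.2 0]

/-- Coordinate-permutation invariance makes the slab sums direction-independent. -/
theorem slabSum_eq_slabSum_zero {a : Site 3 → ℝ} (h : IsHyperoctahedralInvariant a) (i : Fin 3) (n : ℕ) :
    slabSum a i n = slabSum a 0 n := by
  unfold slabSum slabPoint
  refine tsum_congr fun y => ?_
  have h1 : a (Fin.insertNth 1 (n : ℤ) y : Site 3) = a (Fin.insertNth 0 (n : ℤ) y : Site 3) := by
    rw [← h.1 (Equiv.swap 0 1) (Fin.insertNth 1 (n : ℤ) y)]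
    congr 1
    ext j
    fin_cases j <;> rfl
  have h2 : a (Fin.insertNth 2 (n : ℤ) y : Site 3) = a (Fin.insertNth 0 (n : ℤ) y : Site 3) := by
    rw [← h.1 (finRotate 3).symm (Fin.insertNth 2 (n : ℤ) y)]
    congr 1
    ext j
    fin_cases j <;> rfl
  fin_cases i
  · rfl
  · exact h1
  · exact h2

/-- The Hausdorff structure at zero transverse momentum makes the slab sums nonnegative and non-increasing from `n = 1`. -/
theorem slabSum_antitone_of_isSlabHausdorff {a : Site 3 → ℝ} (h : IsSlabHausdorff a) (i : Fin 3) :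
    (∀ n : ℕ, 1 ≤ n → 0 ≤ slabSum a i n) ∧ ∀ n : ℕ, 1 ≤ n → slabSum a i (n + 1) ≤ slabSum a i n := by
  obtain ⟨τ, hfin, hsupp, hmom⟩ := h i 0
  have hmode : ∀ n, slabMode a i n 0 = slabSum a i n := by
    intro n
    unfold slabMode slabSum
    exact tsum_congr fun y => by simp
  have hae : ∀ᵐ t ∂τ, t ∈ Set.Icc (0 : ℝ) 1 := by
    rw [MeasureTheory.ae_iff]
    simpa only [Set.mem_setOf_eq, ← Set.mem_compl_iff, Set.setOf_mem_eq] using hsupp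
  have hint : ∀ k : ℕ, MeasureTheory.Integrable (fun t : ℝ => t ^ k) τ := by
    intro k
    refine MeasureTheory.Integrable.mono' (MeasureTheory.integrable_const (1 : ℝ))
      (measurable_id.pow_const k).aestronglyMeasurable (hae.mono fun t ht => ?_)
    rw [Real.norm_eq_abs, abs_pow, abs_of_nonneg ht.1]
    exact pow_le_one₀ ht.1 ht.2
  refine ⟨fun n hn => ?_, fun n hn => ?_⟩
  · rw [← hmode, hmom n hn]
    exact MeasureTheory.integral_nonneg_of_ae (hae.mono fun t ht => pow_nonneg ht.1 _)
  · rw [← hmode, ← hmode, hmom (n + 1) (by omega), hmom n hn]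
    refine MeasureTheory.integral_mono_ae (hint _) (hint _) (hae.mono fun t ht => ?_)
    exact pow_le_pow_of_le_one ht.1 ht.2 (by omega)

/-- **From the new core to the rev-4 core** (sorry-free glue; package form).  Given stable Lévy scaling of `dcf` with
index `α ∈ (1,2)` and profile `Φ` (stub 6‴), the 1-d Tauberian step (stub 8), the slab reduction (stub 9) and the dilation
identity (stub 10): under `H`, with `dcf ∈ ℓ¹` and Hausdorff slabs (both hypotheses of the rev-4 core — the transverse gap is
not even needed here), `η := 2 − α ∈ (0,1)` and `c := F₀/2 > 0` satisfy `HasRadialAsymptotics dcf η c` (slab sums are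
non-increasing by the Hausdorff structure, even and direction-independent by the landed `stub_dcfStructure`) and
`TailMeasuresConverge dcf η` (literal). -/
theorem core_of_stableLevyScaling
    (h6 : IsSymmPotentialKernel (criticalTwoPoint 3) → ∃ (α : ℝ) (Φ : (Fin 3 → ℝ) → ℝ), 1 < α ∧ α < 2 ∧
      ContinuousOn Φ {u | ∑ i, u i ^ 2 = 1} ∧ (∀ u : Fin 3 → ℝ, ∑ i, u i ^ 2 = 1 → 0 ≤ Φ u) ∧
      (∃ u : Fin 3 → ℝ, ∑ i, u i ^ 2 = 1 ∧ 0 < Φ u) ∧ HasStableLevyScaling dcf α Φ)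
    (h8 : ∀ (S : ℕ → ℝ) (α F : ℝ), 0 < α → (∀ n : ℕ, 1 ≤ n → 0 ≤ S n) → (∀ n : ℕ, 1 ≤ n → S (n + 1) ≤ S n) →
      (∀ g : ℝ → ℝ, Continuous g → HasCompactSupport g → tsupport g ⊆ Set.Ioi 0 →
        Tendsto (fun R : ℕ => (R : ℝ) ^ α * ∑' n : ℕ, S n * g ((n : ℝ) / (R : ℝ))) atTop
          (𝓝 (F * ∫ s in Set.Ioi (0 : ℝ), g s * s ^ (-(1 + α))))) →
      Tendsto (fun n : ℕ => S n * (n : ℝ) ^ (1 + α)) atTop (𝓝 F))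
    (h9 : ∀ (a : Site 3 → ℝ) (α : ℝ) (Ψ : (Fin 3 → ℝ) → ℝ) (i : Fin 3), 0 < α → (∀ x : Site 3, x ≠ 0 → 0 ≤ a x) →
      Summable a → (∀ x : Site 3, a (-x) = a x) →
      (∀ δ : ℝ, 0 < δ → MeasureTheory.IntegrableOn Ψ {y : Fin 3 → ℝ | δ ≤ ‖y‖}) →
      (∀ f : (Fin 3 → ℝ) → ℝ, Continuous f → HasCompactSupport f → (0 : Fin 3 → ℝ) ∉ tsupport f →
        Tendsto (fun R : ℕ => (R : ℝ) ^ α * ∑' x : Site 3, a x * f (fun j => (x j : ℝ) / (R : ℝ)))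
          atTop (𝓝 (∫ y : Fin 3 → ℝ, f y * Ψ y))) →
      ∀ g : ℝ → ℝ, Continuous g → HasCompactSupport g → tsupport g ⊆ Set.Ioi 0 →
        Tendsto (fun R : ℕ => (R : ℝ) ^ α * ∑' n : ℕ, slabSum a i n * g ((n : ℝ) / (R : ℝ))) atTop
          (𝓝 ((1 / 2 : ℝ) * ∫ y : Fin 3 → ℝ, g (|y i|) * Ψ y)))
    (h10 : ∀ (α : ℝ) (Φ : (Fin 3 → ℝ) → ℝ) (i : Fin 3), 0 < α → ContinuousOn Φ {u : Fin 3 → ℝ | ∑ j, u j ^ 2 = 1} →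
      (∀ u : Fin 3 → ℝ, ∑ j, u j ^ 2 = 1 → 0 ≤ Φ u) → (∃ u : Fin 3 → ℝ, ∑ j, u j ^ 2 = 1 ∧ 0 < Φ u) →
      (∀ δ : ℝ, 0 < δ → MeasureTheory.IntegrableOn (levyDensity α Φ) {y : Fin 3 → ℝ | δ ≤ ‖y‖}) ∧
      ∃ F : ℝ, 0 < F ∧ ∀ g : ℝ → ℝ, Continuous g → HasCompactSupport g → tsupport g ⊆ Set.Ioi 0 →
        ∫ y : Fin 3 → ℝ, g (|y i|) * levyDensity α Φ y = F * ∫ s in Set.Ioi (0 : ℝ), g s * s ^ (-(1 + α))) :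
    IsSymmPotentialKernel (criticalTwoPoint 3) → Summable dcf → IsSlabHausdorff dcf → HasTransverseGap dcf →
      ∃ η c : ℝ, 0 < η ∧ η < 1 ∧ 0 < c ∧ HasRadialAsymptotics dcf η c ∧ TailMeasuresConverge dcf η := by
  intro hH hsum hHaus _hGap
  obtain ⟨α, Φ, hα1, hα2, hΦc, hΦ0, hΦpos, hscal⟩ := h6 hH
  have hnn : ∀ x : Site 3, x ≠ 0 → 0 ≤ dcf x := fun x hx => directCorr_nonneg_of_isSymmPotentialKernel hH hx
  have hsymm : IsHyperoctahedralInvariant dcf := ((stub_dcfStructure_iff.mp stub_dcfStructure) hH).2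
  have heven : ∀ x : Site 3, dcf (-x) = dcf x := even_of_isHyperoctahedralInvariant hsymm
  have hα0 : 0 < α := by linarith
  obtain ⟨hint, F, hF, hmarg⟩ := h10 α Φ 0 hα0 hΦc hΦ0 hΦpos
  -- the slab-sum functionals in direction `0` converge to `(F/2) ∫ g(s) s^{-1-α} ds`
  have hslab := h9 dcf α (levyDensity α Φ) 0 hα0 hnn hsum heven hint hscal
  have hmono := slabSum_antitone_of_isSlabHausdorff hHaus 0
  have hrad0 : Tendsto (fun n : ℕ => slabSum dcf 0 n * (n : ℝ) ^ (1 + α)) atTop (𝓝 (F / 2)) := by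
    refine h8 (slabSum dcf 0) α (F / 2) hα0 hmono.1 hmono.2 fun g hg hgc hgs => ?_
    have key := hslab g hg hgc hgs
    rw [hmarg g hg hgc hgs] at key
    convert key using 2
    ring
  refine ⟨2 - α, F / 2, by linarith, by linarith, by positivity, fun i => ?_,
    fun f hf hfc hf0 => ⟨∫ y, f y * levyDensity α Φ y, ?_⟩⟩
  · have hfun : (fun n : ℕ => slabSum dcf i n * (n : ℝ) ^ (3 - (2 - α))) =
        fun n : ℕ => slabSum dcf 0 n * (n : ℝ) ^ (1 + α) := by
      funext n
      rw [slabSum_eq_slabSum_zero hsymm i n, show (3 : ℝ) - (2 - α) = 1 + α by ring]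
    rw [hfun]
    exact hrad0
  · have hfun : (fun R : ℕ => (R : ℝ) ^ (2 - (2 - α)) * ∑' x : Site 3, dcf x * f (fun j => (x j : ℝ) / (R : ℝ))) =
        fun R : ℕ => (R : ℝ) ^ α * ∑' x : Site 3, dcf x * f (fun j => (x j : ℝ) / (R : ℝ)) := by
      funext R
      rw [show (2 : ℝ) - (2 - α) = α by ring]
    rw [hfun]
    exact hscal f hf hfc hf0

/-- **Necessity of the new core** (sorry-free glue over stub 11): a stable tail with data `(η, Φ)` gives stable Lévy scaling
with index `2 − η ∈ (1,2)` and the same angular profile. -/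
theorem stableLevyScaling_of_hasStableTail
    (h11 : ∀ (a : Site 3 → ℝ) (η : ℝ) (Φ : (Fin 3 → ℝ) → ℝ), ContinuousOn Φ {u : Fin 3 → ℝ | ∑ i, u i ^ 2 = 1} →
      Tendsto (fun x : Site 3 => a x * Real.sqrt (∑ j, ((x j : ℝ)) ^ 2) ^ (5 - η) -
        Φ (fun i => (x i : ℝ) / Real.sqrt (∑ j, ((x j : ℝ)) ^ 2))) cofinite (𝓝 0) →
      ∀ f : (Fin 3 → ℝ) → ℝ, Continuous f → HasCompactSupport f → (0 : Fin 3 → ℝ) ∉ tsupport f →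
        Tendsto (fun R : ℕ => (R : ℝ) ^ (2 - η) * ∑' x : Site 3, a x * f (fun j => (x j : ℝ) / (R : ℝ)))
          atTop (𝓝 (∫ y : Fin 3 → ℝ, f y * (Φ (fun j => y j / Real.sqrt (∑ l, y l ^ 2)) *
            Real.sqrt (∑ l, y l ^ 2) ^ (-(5 - η))))))
    {a : Site 3 → ℝ} (hT : HasStableTail a) :
    ∃ (α : ℝ) (Φ : (Fin 3 → ℝ) → ℝ), 1 < α ∧ α < 2 ∧ ContinuousOn Φ {u | ∑ i, u i ^ 2 = 1} ∧
      (∀ u : Fin 3 → ℝ, ∑ i, u i ^ 2 = 1 → 0 ≤ Φ u) ∧ (∃ u : Fin 3 → ℝ, ∑ i, u i ^ 2 = 1 ∧ 0 < Φ u) ∧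
      HasStableLevyScaling a α Φ := by
  obtain ⟨η, Φ, hη0, hη1, hΦc, hΦ0, hΦpos, htail⟩ := hT
  refine ⟨2 - η, Φ, by linarith, by linarith, hΦc, hΦ0, hΦpos, fun f hf hfc hf0 => ?_⟩
  have key := h11 a η Φ hΦc htail f hf hfc hf0
  have hfun : (fun y : Fin 3 → ℝ => f y * levyDensity (2 - η) Φ y) =
      fun y => f y * (Φ (fun j => y j / Real.sqrt (∑ l, y l ^ 2)) * Real.sqrt (∑ l, y l ^ 2) ^ (-(5 - η))) := by
    funext y
    rw [levyDensity, show -(3 + (2 - η)) = -(5 - η) by ring]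
  rw [hfun]
  exact key

/-! ## §5 The composition (kernel-checked, sorry-free logic) and the skeleton theorem (concludes the crux BY NAME) -/

/-- **Skeleton theorem (rev 5).**  The crux `DirectCorrelationStableTail` BY NAME: the landed closure
`stub_closureModuloCore` (rev-4 core ⇒ crux; it packages the landed stubs 1, 2, 3, 4″ (transverse mass gap), 5, 7) applied to
the rev-4 core DERIVED (`core_of_stableLevyScaling`) from the rev-5 registered stubs: the open core `stub_stableLevyScaling`
and the Ising-free `stub_monotoneTauberian`, `stub_slabFunctionalLimit`, `stub_axisMarginal`.  `sorry` lives only inside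
those `stub_*`. -/
theorem DirectCorrelationStableTail_of : DirectCorrelationStableTail :=
  stub_closureModuloCore
    (stub_tailRegularVariation_iff.mpr
      (core_of_stableLevyScaling (stub_stableLevyScaling_iff.mp stub_stableLevyScaling) stub_monotoneTauberian
        (stub_slabFunctionalLimit_iff.mp stub_slabFunctionalLimit) (stub_axisMarginal_iff.mp stub_axisMarginal)))

/-- **The new core is necessary**: the crux implies it (stub 11 + bookkeeping), so rev 5 bets nothing beyond the crux. -/
theorem stableLevyScaling_of_crux (h : DirectCorrelationStableTail) :
    IsSymmPotentialKernel (criticalTwoPoint 3) → ∃ (α : ℝ) (Φ : (Fin 3 → ℝ) → ℝ), 1 < α ∧ α < 2 ∧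
      ContinuousOn Φ {u | ∑ i, u i ^ 2 = 1} ∧ (∀ u : Fin 3 → ℝ, ∑ i, u i ^ 2 = 1 → 0 ≤ Φ u) ∧
      (∃ u : Fin 3 → ℝ, ∑ i, u i ^ 2 = 1 ∧ 0 < Φ u) ∧ HasStableLevyScaling dcf α Φ :=
  fun hH => stableLevyScaling_of_hasStableTail stub_scalingOfStableTail (crux_iff.mp h hH)

/-- Shape check: `IsSymmPotentialKernel (criticalTwoPoint 3)` / `HasStableTail dcf` restate the crux's
antecedent / consequent verbatim. -/
example (h : DirectCorrelationStableTail) (hp : IsSymmPotentialKernel (criticalTwoPoint 3)) : HasStableTail dcf := h hp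

end Summit.CriticalPhenomena.Ising3DConformalLimit.Cruxes.DirectCorrelationStableTail.SelfEnergyPickInversion

end
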